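import Summits.QuantumFields.BalabanUV.Beta.GAN24.DressedWilsonHalfVertex
import Summits.QuantumFields.BalabanUV.Beta.GAN24.DressedHalfVertex

/-!
# (C)sym at level 0 — the EE exchange word lives on FIELD legs: the double composition `(V ∘ X) ∘ W` read at `(inl α, inl β)` only sees the ff blocks
# (blueprint §6 (L1), first step of the outer Fubini)

WHAT. The literal level-0 EE exchange word reads `((V_{μ,u} ∘ X̃♮_0) ∘ V_{ν,u′}) y w (inl α) (inl β)` with `comp A K x z a b = Σ'_m Σ_{c ∈ Fib} A x m a c·K m z c b`
(`ExpKernelCalculus.comp`), the fibre `Fib d = Fin (d+1) ⊕ Fin (d+1)` carrying field (`inl`) and multiplier (`inr`) legs.  The Wilson source table is ff-supported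
(`StepJetData.wilsonA` vanishes on every mixed or mm leg pair BY DEFINITION), so the chain-rule vertex `vertexOfK X N (unitS s_f s_m (cE • wilsonA)) κ u` vanishes on
`(inl, inr)` and `(inr, inl)` legs, and both fibre sums of the double composition collapse to the field legs — with NO summability hypothesis (pointwise zeros):

* §1 `vertexOfK_wilson_inl_inr`, `vertexOfK_wilson_inr_inl` (any kernel `X`, any `N`, all units);
* §2 **`comp_comp_inl_inl`** (GENERAL kernels `V X W` with `V (inl ·)(inr ·) = 0`, `W (inr ·)(inl ·) = 0`):
  `((V ∘ X) ∘ W) y w (inl α)(inl β) = Σ'_z Σ_b (Σ'_{y₁} Σ_a V y y₁ (inl α)(inl a)·X y₁ z (inl a)(inl b))·W z w (inl b)(inl β)` (`Fintype.sum_sum_type` twice);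
* §3 **`comp_comp_vertex_wilson_inl_inl`**: the same for `V = V_{μ,u}`, `W = V_{ν,u′}` over the Wilson table and ANY middle kernel — the integrand of the literal EE word
  in the legs-`inl` form that `EEWordReduced.ee_word_reduced′` evaluates after the outer Fubini (blueprint §6 (L1); the Fubini itself is NOT done here);
* §4 `summable_prod_faceHalfVertex`, **`tsum_prod_faceHalfVertex`** (in-block root, `1 ≤ Lc`, the dressed step kernel `X̃♮_j` inside the vertex): the exit-face-read right
  half-vertex is absolutely summable over (bond, leg) JOINTLY, so `Σ'_{(u′,w)} 𝟙f(w_β)·V_{ν,u′} z w (inl b)(inl β) = Σ'_{u′} Σ'_w (…)` — the product-indexed form in which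
  `ExchangeSlotFubini.hasSum_slot_resum` delivers the resummed slot, identified with the nested form of `DressedWilsonHalfVertex.hasSum_faceHalfVertex_snd`.

HONEST: [folklore] finite fibre algebra BY NAME; no value of Bałaban's tables beyond an3's DEFINED stencil is asserted; (C)sym stays DISPLAYED — nothing of (C)∕(Q-D)∕(Q-D-rate)
is discharged; NEVER «G-an2-4 closed» as (CONV-C); NOT D1, NOT BetaPertH, NOT continuum, NOT Clay.
-/

noncomputable section

open Finset
open scoped BigOperators
open Literature.MathematicalPhysics.QuantumFieldTheory
open Literature.MathematicalPhysics.QuantumFieldTheory.Balaban1983to89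
open Literature.MathematicalPhysics.QuantumFieldTheory.Balaban1983to89.Beta
open B12Sec2to5 (l1 l1_nonneg)
open ExpKernelCalculus (Site MKer comp Decays VertexFamily Zl summable_exp_shift' tsum_exp_shift')
open OneStepResolventKernel (Fib wsum LocStencil)
open OneStepKernelFamily (KInvStep vertexOfK colH vertexFamily_vertexOfK decays_KInvStep)
open StepJetData (wilsonA locStencil_wilsonA locStencil_smul)
open AffineAveraging (box toSite)
open Summit.QuantumFields.BalabanUV.Beta.AxialDressingRooted (coDressKBmAt decays_coDressKBmAt)
open Summit.QuantumFields.BalabanUV.Beta.HessKerDressedUnits (unitK unitS unitS_apply decays_unitK locStencil_unitS)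
open Summit.QuantumFields.BalabanUV.Beta.GAN24.ResolventLegCharges (summable_exp_coarse')

namespace Summit.QuantumFields.BalabanUV.Beta.GAN24.ExchangeFieldLegs

variable {d : ℕ}

/-! ## §1 The chain-rule vertex over the Wilson table vanishes on mixed legs -/

/-- [folklore] `vertexOfK X N (unitS s_f s_m (cE • wilsonA)) κ u y z (inl a) (inr m) = 0` — the Wilson table has no `(inl, inr)` block. -/
theorem vertexOfK_wilson_inl_inr (X : MKer (d + 1) (Fib d)) (N : ℕ) (sf sm cE : ℝ) (κ : Fin (d + 1)) (u y z : Site (d + 1)) (a m : Fin (d + 1)) :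
    vertexOfK X N (unitS sf sm (fun κ' v => cE • wilsonA d κ' v)) κ u y z (Sum.inl a) (Sum.inr m) = 0 := by
  have hw : ∀ (κ' : Fin (d + 1)) (t : Site (d + 1)), wilsonA d κ' t y z (Sum.inl a) (Sum.inr m) = 0 := fun _ _ => rfl
  simp only [vertexOfK, wsum, unitS_apply, Pi.smul_apply, smul_eq_mul, hw, mul_zero, zero_mul, tsum_zero, Finset.sum_const_zero]

/-- [folklore] `vertexOfK X N (unitS s_f s_m (cE • wilsonA)) κ u y z (inr m) (inl b) = 0` — the Wilson table has no `(inr, inl)` block. -/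
theorem vertexOfK_wilson_inr_inl (X : MKer (d + 1) (Fib d)) (N : ℕ) (sf sm cE : ℝ) (κ : Fin (d + 1)) (u y z : Site (d + 1)) (m b : Fin (d + 1)) :
    vertexOfK X N (unitS sf sm (fun κ' v => cE • wilsonA d κ' v)) κ u y z (Sum.inr m) (Sum.inl b) = 0 := by
  have hw : ∀ (κ' : Fin (d + 1)) (t : Site (d + 1)), wilsonA d κ' t y z (Sum.inr m) (Sum.inl b) = 0 := fun _ _ => rfl
  simp only [vertexOfK, wsum, unitS_apply, Pi.smul_apply, smul_eq_mul, hw, mul_zero, zero_mul, tsum_zero, Finset.sum_const_zero]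

/-! ## §2 The double composition read on field legs -/

/-- [folklore] **THE DOUBLE COMPOSITION READ AT `(inl α, inl β)` ONLY SEES THE ff BLOCKS** (general kernels; `V` with no `(inl, inr)` block, `W` with no `(inr, inl)` block):
`((V ∘ X) ∘ W) y w (inl α)(inl β) = Σ'_z Σ_b (Σ'_{y₁} Σ_a V y y₁ (inl α)(inl a)·X y₁ z (inl a)(inl b))·W z w (inl b)(inl β)` — both fibre sums split by `Fintype.sum_sum_type`
and their multiplier halves vanish termwise; NO summability is needed. -/
theorem comp_comp_inl_inl {V X W : MKer (d + 1) (Fib d)} (hV : ∀ (y z : Site (d + 1)) (a m : Fin (d + 1)), V y z (Sum.inl a) (Sum.inr m) = 0)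
    (hW : ∀ (y z : Site (d + 1)) (m b : Fin (d + 1)), W y z (Sum.inr m) (Sum.inl b) = 0) (y w : Site (d + 1)) (α β : Fin (d + 1)) :
    comp (comp V X) W y w (Sum.inl α) (Sum.inl β) =
      ∑' z : Site (d + 1), ∑ b : Fin (d + 1), (∑' y₁ : Site (d + 1), ∑ a : Fin (d + 1), V y y₁ (Sum.inl α) (Sum.inl a) * X y₁ z (Sum.inl a) (Sum.inl b)) *
        W z w (Sum.inl b) (Sum.inl β) := by
  simp only [comp, Fintype.sum_sum_type, hV, hW, zero_mul, mul_zero, Finset.sum_const_zero, add_zero]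

/-! ## §3 The integrand of the literal EE word on field legs -/

/-- [folklore] **THE LITERAL EE INTEGRAND ON FIELD LEGS** (any middle kernel `X`, any `N`, all units, any bonds `(μ, u)`, `(ν, u′)`):
`((V_{μ,u} ∘ X) ∘ V_{ν,u′}) y w (inl α)(inl β) = Σ'_z Σ_b (Σ'_{y₁} Σ_a V_{μ,u} y y₁ (inl α)(inl a)·X y₁ z (inl a)(inl b))·V_{ν,u′} z w (inl b)(inl β)`,
`V_{κ,v} = vertexOfK X′ N (unitS s_f s_m (cE • wilsonA)) κ v` for any `X′` — §2 with §1. -/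
theorem comp_comp_vertex_wilson_inl_inl (X' X : MKer (d + 1) (Fib d)) (N : ℕ) (sf sm cE : ℝ) (μ ν : Fin (d + 1)) (u u' y w : Site (d + 1)) (α β : Fin (d + 1)) :
    comp (comp (vertexOfK X' N (unitS sf sm (fun κ' v => cE • wilsonA d κ' v)) μ u) X) (vertexOfK X' N (unitS sf sm (fun κ' v => cE • wilsonA d κ' v)) ν u') y w
        (Sum.inl α) (Sum.inl β) =
      ∑' z : Site (d + 1), ∑ b : Fin (d + 1),
        (∑' y₁ : Site (d + 1), ∑ a : Fin (d + 1), vertexOfK X' N (unitS sf sm (fun κ' v => cE • wilsonA d κ' v)) μ u y y₁ (Sum.inl α) (Sum.inl a) *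
          X y₁ z (Sum.inl a) (Sum.inl b)) *
        vertexOfK X' N (unitS sf sm (fun κ' v => cE • wilsonA d κ' v)) ν u' z w (Sum.inl b) (Sum.inl β) :=
  comp_comp_inl_inl (fun y z a m => vertexOfK_wilson_inl_inr X' N sf sm cE μ u y z a m) (fun y z m b => vertexOfK_wilson_inr_inl X' N sf sm cE ν u' y z m b) y w α β


/-! ## §4 The exit-face-read half-vertex is jointly summable over (bond, leg) -/

section Joint

variable {Lc : ℕ} [NeZero Lc] {r : Fin (d + 1) → ℕ}

/-- [folklore] **JOINT SUMMABILITY OVER (BOND, LEG)** of the exit-face-read dressed half-vertex `(u′, w) ↦ 𝟙f(w_β)·vertexOfK X̃♮_j Lc S^E ν u′ z w (inl b)(inl β)`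
(in-block root, `1 ≤ Lc`; majorant `C_v·e^{−δ_v|z − Lc u′|}·e^{−δ_v|w − Lc u′|}` from `vertexFamily_vertexOfK`, summed by `tsum_exp_shift'` and leaf-06's
`ResolventLegCharges.summable_exp_coarse'`). -/
theorem summable_prod_faceHalfVertex (hLc : 1 ≤ Lc) (hr : r ∈ box (d + 1) Lc) (sf sm cE : ℝ) (j : ℕ) (ν β : Fin (d + 1)) (z : Site (d + 1)) (b : Fin (d + 1)) :
    Summable fun uw : Site (d + 1) × Site (d + 1) => (if uw.2 β % (Lc : ℤ) = (Lc : ℤ) - 1 then (1 : ℝ) else 0) *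
      vertexOfK (unitK sf sm (coDressKBmAt (toSite r) Lc (KInvStep (d := d) Lc j))) Lc (unitS sf sm (fun κ v => cE • wilsonA d κ v)) ν uw.1 z uw.2
        (Sum.inl b) (Sum.inl β) := by
  obtain ⟨δK, CK, hδK, hCK, hXd⟩ := decays_coDressKBmAt hLc hr (decays_KInvStep (d := d) (Lc := Lc) j)
  have hXu := decays_unitK (sf := sf) (sm := sm) hXd
  have hS := locStencil_unitS (sf := sf) (sm := sm) (locStencil_smul cE (locStencil_wilsonA (d := d) hδK.le))
  have hC : 0 ≤ max |sf| |sm| * CK * max |sf| |sm| := by positivity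
  obtain ⟨Cv, hVF⟩ : ∃ Cv : ℝ, VertexFamily (vertexOfK (unitK sf sm (coDressKBmAt (toSite r) Lc (KInvStep (d := d) Lc j))) Lc
      (unitS sf sm (fun κ v => cE • wilsonA d κ v))) Lc Cv (δK / 2) := ⟨_, vertexFamily_vertexOfK (N := Lc) hXu hC hS hδK le_rfl⟩
  have hCv0 : 0 ≤ Cv := (hVF ν 0).nonneg (Sum.inl 0)
  set V := vertexOfK (unitK sf sm (coDressKBmAt (toSite r) Lc (KInvStep (d := d) Lc j))) Lc (unitS sf sm (fun κ v => cE • wilsonA d κ v)) with hVdef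
  set M : Site (d + 1) × Site (d + 1) → ℝ := fun uw =>
    Cv * Real.exp (-(δK / 2) * l1 (z - (Lc : ℤ) • uw.1)) * Real.exp (-(δK / 2) * l1 (uw.2 - (Lc : ℤ) • uw.1)) with hM
  have hM0 : 0 ≤ M := fun uw => by positivity
  have hMs : Summable M := by
    refine (summable_prod_of_nonneg hM0).2 ⟨fun u' => ?_, ?_⟩
    · exact (summable_exp_shift' (half_pos hδK) ((Lc : ℤ) • u')).mul_left (Cv * Real.exp (-(δK / 2) * l1 (z - (Lc : ℤ) • u')))
    · have e : ∀ u' : Site (d + 1), ∑' w : Site (d + 1), M (u', w) = Cv * Real.exp (-(δK / 2) * l1 (z - (Lc : ℤ) • u')) * Zl (d + 1) (δK / 2) := by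
        intro u'
        simp only [hM]
        rw [tsum_mul_left, tsum_exp_shift']
      refine (((summable_exp_coarse' (d := d) hLc (half_pos hδK) z).mul_left Cv).mul_right (Zl (d + 1) (δK / 2))).congr fun u' => ?_
      rw [e]
  refine Summable.of_norm_bounded hMs (fun uw => ?_)
  rw [Real.norm_eq_abs, abs_mul]
  have h1 : |(if uw.2 β % (Lc : ℤ) = (Lc : ℤ) - 1 then (1 : ℝ) else 0)| ≤ 1 := by split_ifs <;> simp
  have h2 := hVF ν uw.1 z uw.2 (Sum.inl b) (Sum.inl β)
  rw [mul_add, Real.exp_add, ← mul_assoc] at h2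
  calc |(if uw.2 β % (Lc : ℤ) = (Lc : ℤ) - 1 then (1 : ℝ) else 0)| * |V ν uw.1 z uw.2 (Sum.inl b) (Sum.inl β)| ≤ 1 * M uw :=
        mul_le_mul h1 h2 (abs_nonneg _) zero_le_one
    _ = M uw := one_mul _

/-- [folklore] **PRODUCT-INDEXED = NESTED**: `Σ'_{(u′,w)} 𝟙f(w_β)·V_{ν,u′} z w (inl b)(inl β) = Σ'_{u′} Σ'_w 𝟙f(w_β)·V_{ν,u′} z w (inl b)(inl β)` (`Summable.tsum_prod` over §4's joint
summability) — the form in which `ExchangeSlotFubini.hasSum_slot_resum` returns the resummed right slot, matched to `DressedWilsonHalfVertex.hasSum_faceHalfVertex_snd`. -/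
theorem tsum_prod_faceHalfVertex (hLc : 1 ≤ Lc) (hr : r ∈ box (d + 1) Lc) (sf sm cE : ℝ) (j : ℕ) (ν β : Fin (d + 1)) (z : Site (d + 1)) (b : Fin (d + 1)) :
    ∑' uw : Site (d + 1) × Site (d + 1), (if uw.2 β % (Lc : ℤ) = (Lc : ℤ) - 1 then (1 : ℝ) else 0) *
        vertexOfK (unitK sf sm (coDressKBmAt (toSite r) Lc (KInvStep (d := d) Lc j))) Lc (unitS sf sm (fun κ v => cE • wilsonA d κ v)) ν uw.1 z uw.2
          (Sum.inl b) (Sum.inl β) =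
      ∑' u' : Site (d + 1), ∑' w : Site (d + 1), (if w β % (Lc : ℤ) = (Lc : ℤ) - 1 then (1 : ℝ) else 0) *
        vertexOfK (unitK sf sm (coDressKBmAt (toSite r) Lc (KInvStep (d := d) Lc j))) Lc (unitS sf sm (fun κ v => cE • wilsonA d κ v)) ν u' z w
          (Sum.inl b) (Sum.inl β) :=
  (summable_prod_faceHalfVertex hLc hr sf sm cE j ν β z b).tsum_prod

end Joint

end Summit.QuantumFields.BalabanUV.Beta.GAN24.ExchangeFieldLegs

end
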